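import Literature.Probability.RandomPlanarGeometry.SAWAdsorptionIrreducibleBridges
import Literature.Probability.RandomPlanarGeometry.SAWUnfoldingTwoSided
import HarnessLib

/-!
# Arches of the half-plane walk fold onto wall-returning `x`-bridges, heights preserved:
# `a · A_k(a) ≤ e^{6√k} · B_{k+1}(a)`, and the last-visit split `Z⁺_n(a) ≤ Σ_k A_k(a) c_{n-k}`

Topic `Literature/Probability/RandomPlanarGeometry` (continues `SAWAdsorptionIrreducibleBridges.lean` — the half-plane
walks `Zd.hpWalks n` of `ℤ²` with the wall `x₀ = 0`, `Zd.wallVisits`, `Zd.adsZ n a = Z⁺_n(a)`, the wall-returning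
`x`-bridges `AdsIrr.IsWXB` and `B_n(a) = AdsIrr.Bw n a` — and `SAWUnfoldingTwoSided.lean`, the two-sided
Hammersley–Welsh fold `Zd.fold` of Duminil-Copin–Kozma–Yadin 2014).

Hammersley–Torrie–Whittington 1982 prove that the adsorption free energy `κ(a) = lim n⁻¹ log Z⁺_n(a)` exists for every
`a > 0` (reported in Beaton–Guttmann–Jensen 2012, §1 p. 1 of arXiv:1110.6695v1: «It has been shown by Hammersley, Torrie and Whittington [HTW82] … that the limit lim n⁻¹ log Z_n(α) ≡ κ(α) exists»). The combinatorial heart of the bridge route to that theorem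
is an unfolding IN THE DIRECTION OF THE WALL which does not move heights, hence does not change wall visits. The tree's
fold (transpose, then reverse–unfold–reverse–unfold in the first coordinate) is exactly such a map: `(fold ω)(i)₁ = ω(i)₀`
(`Zd.fold_apply_one`), the first coordinate of `fold ω` lies in `[0, (fold ω)(k)₀]`, and `ω ↦ (fold ω, two codes)` is
injective (`Zd.fold_codes_injOn`), the codes ranging over `≤ e^{3√k}` sets each.

* An **arch** is a half-plane walk ending on the wall (`Zd.arches k`, weighted count `Zd.archZ k a = A_k(a)`).
  Folding an arch and appending one unit step along the wall gives a wall-returning `x`-bridge of length `k+1` with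
  exactly one more wall visit (`Zd.archWord`, `Zd.isWXB_archWord`, `Zd.visits_archWord`); hence
  **`Zd.mul_archZ_le : a · A_k(a) ≤ (#codes_k)² · B_{k+1}(a)`** and **`Zd.mul_archZ_le_exp : a · A_k(a) ≤ e^{6√k} B_{k+1}(a)`**
  (`a ≥ 0`).
* Cutting a half-plane walk at its LAST wall visit gives an arch and a free self-avoiding walk; the visits are those of
  the arch: **`Zd.adsZ_le_sum_archZ_mul_count : Z⁺_n(a) ≤ Σ_{k ≤ n} A_k(a) · c_{n-k}`** (`a ≥ 0`).

The sequel `SAWAdsorptionFreeEnergy.lean` combines these with `B_n(a) ≤ β(a)ⁿ` (`SAWAdsorptionBridgeGrowthRate.lean`) and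
`c_m ≤ (m+1) e^{6√(m+1)} μ^{m+1}` into the existence of `κ(a) = log max(β(a), μ)`. Pure standard axioms.

Label: CONSOLIDATION — a printed theorem (Hammersley–Torrie–Whittington 1982, cited via Beaton–Guttmann–Jensen 2012,
§1 p. 1) given a NEW kernel proof by the bridge/unfolding route (wall-returning `x`-bridges and the two-sided fold); the
primary source HTW82 is not held by the lane, so no statement here is quoted from it. (Lane «pcv-sawmu», a-p3 g9.)
-/

noncomputable section

open Finset Function Literature.Probability.LatticeModels Literature.Probability.Percolation SimpleGraph
open Literature.Combinatorics.Enumerative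
open scoped BigOperators

namespace Literature.Probability.RandomPlanarGeometry.SAW

/-- Reindexing inequality: an injection into a finset carrying nonnegative weights. [folklore] -/
private theorem sum_comp_le_sum_of_injOn {ι κ : Type*} [DecidableEq κ] {s : Finset ι} {t : Finset κ}
    (e : ι → κ) (he : Set.InjOn e s) (hst : ∀ x ∈ s, e x ∈ t) (g : κ → ℝ)
    (hg : ∀ y ∈ t, 0 ≤ g y) : ∑ x ∈ s, g (e x) ≤ ∑ y ∈ t, g y := by
  rw [← Finset.sum_image (f := g) he]
  exact Finset.sum_le_sum_of_subset_of_nonneg (Finset.image_subset_iff.2 hst) fun b hb _ => hg b hb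

namespace Zd

/-! ### Half-plane walks and arches -/

/-- Membership in `hpWalks`. [cite: BeatonGuttmannJensen2012Adsorption, §1 (p. 2)] -/
theorem mem_hpWalks {n : ℕ} {ω : ℕ → Site 2} : ω ∈ hpWalks n ↔ ω ∈ saws 2 n ∧ ∀ i ≤ n, 0 ≤ ω i 0 := by
  classical
  exact Finset.mem_filter

open Classical in
/-- **Arches**: `k`-step half-plane walks from the origin (on the wall `x₀ = 0`) that END on the wall.
[cite: HammersleyTorrieWhittington1982, existence of the free energy κ; reported in BeatonGuttmannJensen2012Adsorption §1 p. 1 (arXiv:1110.6695v1)] [cite: BeatonGuttmannJensen2012Adsorption, §1 (p. 2)] -/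
def arches (k : ℕ) : Finset (ℕ → Site 2) := (hpWalks k).filter fun ω => ω k 0 = 0

/-- Membership in `arches`. [cite: BeatonGuttmannJensen2012Adsorption, §1 (p. 2)] -/
theorem mem_arches {k : ℕ} {ω : ℕ → Site 2} : ω ∈ arches k ↔ ω ∈ hpWalks k ∧ ω k 0 = 0 := by
  classical
  exact Finset.mem_filter

/-- **`A_k(a) = Σ_{arches of length k} a^{wall visits}`**, the partition function of arches.
[cite: HammersleyTorrieWhittington1982, existence of the free energy κ; reported in BeatonGuttmannJensen2012Adsorption §1 p. 1 (arXiv:1110.6695v1)] [cite: BeatonGuttmannJensen2012Adsorption, §1 (p. 2)] -/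
def archZ (k : ℕ) (a : ℝ) : ℝ := ∑ ω ∈ arches k, a ^ wallVisits k ω

/-- `A_k(a) ≥ 0` for `a ≥ 0`. [cite: MadrasSlade1993, §1.1–§1.2 (pp. 9–11)] -/
theorem archZ_nonneg (k : ℕ) {a : ℝ} (ha : 0 ≤ a) : 0 ≤ archZ k a :=
  Finset.sum_nonneg fun _ _ => pow_nonneg ha _

/-! ### The last-visit split `Z⁺_n(a) ≤ Σ_k A_k(a) c_{n-k}` -/

/-- The last time `≤ n` at which the walk is on the wall. [cite: HammersleyTorrieWhittington1982, existence of the free energy κ; reported in BeatonGuttmannJensen2012Adsorption §1 p. 1 (arXiv:1110.6695v1)] -/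
def lastWallVisit (n : ℕ) (ω : ℕ → Site 2) : ℕ := Nat.findGreatest (fun k => ω k 0 = 0) n

/-- `lastWallVisit n ω ≤ n`. [cite: MadrasSlade1993, §1.1–§1.2 (pp. 9–11)] -/
theorem lastWallVisit_le (n : ℕ) (ω : ℕ → Site 2) : lastWallVisit n ω ≤ n := Nat.findGreatest_le n

/-- The walk is on the wall at its last visit (it starts there). [cite: MadrasSlade1993, §1.1–§1.2 (pp. 9–11)] -/
theorem apply_lastWallVisit {n : ℕ} {ω : ℕ → Site 2} (h0 : ω 0 = 0) : ω (lastWallVisit n ω) 0 = 0 :=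
  Nat.findGreatest_spec (P := fun k => ω k 0 = 0) (Nat.zero_le n) (by simp [h0])

/-- After the last visit the walk is off the wall. [cite: MadrasSlade1993, §1.1–§1.2 (pp. 9–11)] -/
theorem apply_ne_zero_of_lastWallVisit_lt {n : ℕ} {ω : ℕ → Site 2} {i : ℕ} (h1 : lastWallVisit n ω < i) (h2 : i ≤ n) :
    ω i 0 ≠ 0 :=
  Nat.findGreatest_is_greatest h1 h2

/-- The first `k` steps of a walk (frozen from time `k` on). [folklore] -/
def prefixWalk (k : ℕ) (ω : ℕ → Site 2) : ℕ → Site 2 := fun i => ω (min i k)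

/-- The steps `k, …, k+m` of a walk, re-based at `0` (frozen from time `m` on). [folklore] -/
def suffixWalk (k m : ℕ) (ω : ℕ → Site 2) : ℕ → Site 2 := fun i => ω (k + min i m) - ω k

/-- A prefix of a self-avoiding walk is a self-avoiding walk. [cite: MadrasSlade1993, §1.2, eq. (1.2.3)] -/
theorem prefixWalk_mem_saws {n k : ℕ} {ω : ℕ → Site 2} (hω : ω ∈ saws 2 n) (hk : k ≤ n) :
    prefixWalk k ω ∈ saws 2 k := by
  obtain ⟨h0, -, hadj, hinj⟩ := mem_saws.1 hω
  refine mem_saws.2 ⟨by simp [prefixWalk, h0], fun i hi => by simp [prefixWalk, min_eq_right hi], fun i hi => ?_,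
    fun i hi j hj hij => ?_⟩
  · have h1 : min i k = i := min_eq_left hi.le
    have h2 : min (i + 1) k = i + 1 := min_eq_left (by omega)
    simp only [prefixWalk, h1, h2]
    exact hadj i (by omega)
  · simp only [Set.mem_setOf_eq] at hi hj
    simp only [prefixWalk, min_eq_left hi, min_eq_left hj] at hij
    exact hinj (by simp only [Set.mem_setOf_eq]; omega) (by simp only [Set.mem_setOf_eq]; omega) hij

/-- A re-based suffix of a self-avoiding walk is a self-avoiding walk. [cite: MadrasSlade1993, §1.2, eq. (1.2.3)] -/
theorem suffixWalk_mem_saws {n k m : ℕ} {ω : ℕ → Site 2} (hω : ω ∈ saws 2 n) (hkm : k + m ≤ n) :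
    suffixWalk k m ω ∈ saws 2 m := by
  obtain ⟨-, -, hadj, hinj⟩ := mem_saws.1 hω
  refine mem_saws.2 ⟨by simp [suffixWalk], fun i hi => by simp [suffixWalk, min_eq_right hi], fun i hi => ?_,
    fun i hi j hj hij => ?_⟩
  · have h1 : min i m = i := min_eq_left hi.le
    have h2 : min (i + 1) m = i + 1 := min_eq_left (by omega)
    simp only [suffixWalk, h1, h2]
    rw [zdGraph_adj_sub_right, ← add_assoc]
    exact hadj (k + i) (by omega)
  · simp only [Set.mem_setOf_eq] at hi hj
    simp only [suffixWalk, min_eq_left hi, min_eq_left hj, sub_left_inj] at hij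
    have := hinj (by simp only [Set.mem_setOf_eq]; omega) (by simp only [Set.mem_setOf_eq]; omega) hij
    omega

/-- A walk is recovered from its first `k` steps and its re-based suffix. [cite: MadrasSlade1993, §1.2, eq. (1.2.3)] -/
theorem prefix_suffix_injOn {n k : ℕ} (hk : k ≤ n) :
    Set.InjOn (fun ω : ℕ → Site 2 => (prefixWalk k ω, suffixWalk k (n - k) ω)) ↑(saws 2 n) := by
  intro ω hω ω' hω' h
  rw [Finset.mem_coe, mem_saws] at hω hω'
  simp only [Prod.mk.injEq] at h
  obtain ⟨h1, h2⟩ := h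
  have hn : ω k = ω' k := by simpa [prefixWalk] using congrFun h1 k
  funext i
  rcases le_or_gt i k with hi | hi
  · simpa [prefixWalk, min_eq_left hi] using congrFun h1 i
  · obtain ⟨j, rfl⟩ : ∃ j, i = k + j := ⟨i - k, by omega⟩
    rcases le_or_gt j (n - k) with hj | hj
    · have := congrFun h2 j
      simp only [suffixWalk, min_eq_left hj] at this
      rwa [hn, sub_left_inj] at this
    · have := congrFun h2 (n - k)
      simp only [suffixWalk, min_self] at this
      rw [hn, sub_left_inj, Nat.add_sub_cancel' hk] at this
      rw [hω.2.1 (k + j) (by omega), hω'.2.1 (k + j) (by omega), this]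

/-- The prefix of a half-plane walk up to its last wall visit is an arch. [cite: HammersleyTorrieWhittington1982, existence of the free energy κ; reported in BeatonGuttmannJensen2012Adsorption §1 p. 1 (arXiv:1110.6695v1)] -/
theorem prefixWalk_lastWallVisit_mem_arches {n : ℕ} {ω : ℕ → Site 2} (hω : ω ∈ hpWalks n) :
    prefixWalk (lastWallVisit n ω) ω ∈ arches (lastWallVisit n ω) := by
  obtain ⟨hs, hpos⟩ := mem_hpWalks.1 hω
  have hk := lastWallVisit_le n ω
  refine mem_arches.2 ⟨mem_hpWalks.2 ⟨prefixWalk_mem_saws hs hk, fun i hi => ?_⟩, ?_⟩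
  · simp only [prefixWalk, min_eq_left hi]
    exact hpos i (hi.trans hk)
  · simp only [prefixWalk, min_self]
    exact apply_lastWallVisit (mem_saws.1 hs).1

/-- All wall visits happen up to the last one: the arch carries the whole weight.
[cite: HammersleyTorrieWhittington1982, existence of the free energy κ; reported in BeatonGuttmannJensen2012Adsorption §1 p. 1 (arXiv:1110.6695v1)] -/
theorem wallVisits_prefixWalk_lastWallVisit {n : ℕ} {ω : ℕ → Site 2} :
    wallVisits (lastWallVisit n ω) (prefixWalk (lastWallVisit n ω) ω) = wallVisits n ω := by
  classical
  unfold wallVisits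
  have hk := lastWallVisit_le n ω
  apply Finset.card_bij (fun i _ => i)
  · intro i hi
    simp only [Finset.mem_filter, Finset.mem_range, prefixWalk] at hi ⊢
    rw [min_eq_left (by omega)] at hi
    exact ⟨by omega, hi.2.1, hi.2.2⟩
  · intro i _ j _ h; exact h
  · intro j hj
    simp only [Finset.mem_filter, Finset.mem_range] at hj
    refine ⟨j, ?_, rfl⟩
    have hjk : j ≤ lastWallVisit n ω := by
      by_contra h
      exact apply_ne_zero_of_lastWallVisit_lt (not_le.1 h) (by omega) hj.2.2
    simp only [Finset.mem_filter, Finset.mem_range, prefixWalk, min_eq_left hjk]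
    exact ⟨by omega, hj.2.1, hj.2.2⟩

/-- The walks with last visit at time `k` weigh at most `A_k(a) · c_{n-k}`. [cite: HammersleyTorrieWhittington1982, existence of the free energy κ; reported in BeatonGuttmannJensen2012Adsorption §1 p. 1 (arXiv:1110.6695v1)] -/
theorem sum_filter_lastWallVisit_le {n k : ℕ} (hkn : k ≤ n) {a : ℝ} (ha : 0 ≤ a) :
    ∑ ω ∈ (hpWalks n).filter (fun ω => lastWallVisit n ω = k), a ^ wallVisits n ω ≤
      archZ k a * (count 2 (n - k) : ℝ) := by
  classical
  set S := (hpWalks n).filter (fun ω => lastWallVisit n ω = k) with hS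
  have hmemS : ∀ ω ∈ S, ω ∈ hpWalks n ∧ lastWallVisit n ω = k := fun ω hω => Finset.mem_filter.1 hω
  -- the weight is carried by the prefix
  have heq : ∀ ω ∈ S, a ^ wallVisits n ω = a ^ wallVisits k (prefixWalk k ω) := by
    intro ω hω
    obtain ⟨-, hk⟩ := hmemS ω hω
    rw [← hk, wallVisits_prefixWalk_lastWallVisit]
  rw [Finset.sum_congr rfl heq]
  -- inject `S` into `arches k × saws (n-k)`
  have hle : ∑ ω ∈ S, a ^ wallVisits k (prefixWalk k ω) ≤
      ∑ p ∈ arches k ×ˢ saws 2 (n - k), a ^ wallVisits k p.1 :=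
    sum_comp_le_sum_of_injOn (s := S) (t := arches k ×ˢ saws 2 (n - k))
      (fun ω => (prefixWalk k ω, suffixWalk k (n - k) ω))
      (fun ω hω ω' hω' h => prefix_suffix_injOn hkn (Finset.mem_coe.2 (mem_hpWalks.1 (hmemS ω hω).1).1)
        (Finset.mem_coe.2 (mem_hpWalks.1 (hmemS ω' hω').1).1) h)
      (fun ω hω => by
        obtain ⟨hω', hk⟩ := hmemS ω hω
        rw [Finset.mem_product]
        refine ⟨?_, suffixWalk_mem_saws (mem_hpWalks.1 hω').1 (by omega)⟩
        have h := prefixWalk_lastWallVisit_mem_arches hω'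
        rwa [hk] at h)
      (fun p => a ^ wallVisits k p.1) (fun _ _ => pow_nonneg ha _)
  refine hle.trans (le_of_eq ?_)
  rw [Finset.sum_product, archZ, Finset.sum_mul]
  refine Finset.sum_congr rfl fun ω _ => ?_
  simp only [Finset.sum_const, card_saws, nsmul_eq_mul, mul_comm]

/-- **The last-visit split: `Z⁺_n(a) ≤ Σ_{k=0}^{n} A_k(a) · c_{n-k}`** (`a ≥ 0`) — cut a half-plane walk at its last
wall visit: the first piece is an arch with the same wall visits, the second a free self-avoiding walk.
[cite: HammersleyTorrieWhittington1982, existence of the free energy κ; reported in BeatonGuttmannJensen2012Adsorption §1 p. 1 (arXiv:1110.6695v1)] [cite: MadrasSlade1993, §1.2, eq. (1.2.3)] -/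
theorem adsZ_le_sum_archZ_mul_count (n : ℕ) {a : ℝ} (ha : 0 ≤ a) :
    adsZ n a ≤ ∑ k ∈ Finset.range (n + 1), archZ k a * (count 2 (n - k) : ℝ) := by
  classical
  unfold adsZ
  rw [← Finset.sum_fiberwise_of_maps_to (s := hpWalks n) (t := Finset.range (n + 1)) (g := lastWallVisit n)
    (fun ω _ => Finset.mem_range.2 (Nat.lt_succ_of_le (lastWallVisit_le n ω)))]
  exact Finset.sum_le_sum fun k hk => sum_filter_lastWallVisit_le (Nat.le_of_lt_succ (Finset.mem_range.1 hk)) ha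

/-! ### Folding an arch onto a wall-returning `x`-bridge -/

/-- Append one unit step in the first coordinate after time `k` (frozen afterwards). [folklore] -/
def snocStep (k : ℕ) (φ : ℕ → Site 2) : ℕ → Site 2 := fun i => if i ≤ k then φ i else φ k + Pi.single 0 1

/-- Values of `snocStep` up to time `k`. [cite: MadrasSlade1993, §1.1–§1.2 (pp. 9–11)] -/
theorem snocStep_of_le {k i : ℕ} (φ : ℕ → Site 2) (hi : i ≤ k) : snocStep k φ i = φ i := if_pos hi

/-- Values of `snocStep` after time `k`. [cite: MadrasSlade1993, §1.1–§1.2 (pp. 9–11)] -/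
theorem snocStep_of_lt {k i : ℕ} (φ : ℕ → Site 2) (hi : k < i) : snocStep k φ i = φ k + Pi.single 0 1 :=
  if_neg (not_le.2 hi)

/-- The appended vertex has first coordinate one more than the old endpoint. [cite: MadrasSlade1993, §1.1–§1.2 (pp. 9–11)] -/
theorem snocStep_succ_apply_zero (k : ℕ) (φ : ℕ → Site 2) : snocStep k φ (k + 1) 0 = φ k 0 + 1 := by
  rw [snocStep_of_lt φ (Nat.lt_succ_self k)]
  simp

/-- The appended vertex has the second coordinate of the old endpoint. [cite: MadrasSlade1993, §1.1–§1.2 (pp. 9–11)] -/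
theorem snocStep_succ_apply_one (k : ℕ) (φ : ℕ → Site 2) : snocStep k φ (k + 1) 1 = φ k 1 := by
  rw [snocStep_of_lt φ (Nat.lt_succ_self k)]
  simp

/-- If the first coordinate of a `k`-step self-avoiding walk is maximal at the end, appending one unit step in the
first coordinate gives a `(k+1)`-step self-avoiding walk. [cite: MadrasSlade1993, §1.2 (p. 11)] -/
theorem snocStep_mem_saws {k : ℕ} {φ : ℕ → Site 2} (hφ : φ ∈ saws 2 k) (hmax : ∀ i ≤ k, φ i 0 ≤ φ k 0) :
    snocStep k φ ∈ saws 2 (k + 1) := by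
  obtain ⟨h0, -, hadj, hinj⟩ := mem_saws.1 hφ
  refine mem_saws.2 ⟨by rw [snocStep_of_le φ (Nat.zero_le k), h0], fun i hi => ?_, fun i hi => ?_, ?_⟩
  · rw [snocStep_of_lt φ (by omega), snocStep_of_lt φ (by omega)]
  · rcases Nat.lt_or_ge i k with hik | hik
    · rw [snocStep_of_le φ hik.le, snocStep_of_le φ (by omega)]
      exact hadj i hik
    · have hi' : i = k := by omega
      subst hi'
      rw [snocStep_of_le φ le_rfl, snocStep_of_lt φ (Nat.lt_succ_self i)]
      exact (zdGraph_adj_iff_sub _ _).2 ⟨0, Or.inl (by simp)⟩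
  · -- injectivity: the new vertex is to the right of every old one
    have hnew : ∀ i ≤ k, φ i ≠ snocStep k φ (k + 1) := by
      intro i hi h
      have h' := congrFun h 0
      rw [snocStep_succ_apply_zero] at h'
      have := hmax i hi
      omega
    intro i hi j hj hij
    simp only [Set.mem_setOf_eq] at hi hj
    rcases Nat.lt_or_ge i (k + 1) with hik | hik <;> rcases Nat.lt_or_ge j (k + 1) with hjk | hjk
    · rw [snocStep_of_le φ (by omega), snocStep_of_le φ (by omega)] at hij
      exact hinj (show i ∈ {i | i ≤ k} by simp only [Set.mem_setOf_eq]; omega)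
        (show j ∈ {i | i ≤ k} by simp only [Set.mem_setOf_eq]; omega) hij
    · have hj' : j = k + 1 := by omega
      subst hj'
      rw [snocStep_of_le φ (by omega)] at hij
      exact absurd hij (hnew i (by omega))
    · have hi' : i = k + 1 := by omega
      subst hi'
      rw [snocStep_of_le φ (show j ≤ k by omega)] at hij
      exact absurd hij.symm (hnew j (by omega))
    · omega

/-- The first coordinate of the fold lies in `[0, its final value]` (minimum at the start after stage 2, maximum at the
end after the last unfolding). [cite: DuminilCopinKozmaYadin2014, Lemma 5 (proof, Step 1)] -/
theorem fold_apply_zero_mem {k : ℕ} {ω : ℕ → Site 2} (hω : ω ∈ saws 2 k) {i : ℕ} (hi : i ≤ k) :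
    0 ≤ fold k ω i 0 ∧ fold k ω i 0 ≤ fold k ω k 0 := by
  have hs2 := foldStage2_mem_saws hω
  have hF := fold_mem_saws hω
  obtain ⟨hF0, -, -, -⟩ := mem_saws.1 hF
  have hmin := weakHalfSpace_iterate_unfoldStep (foldStage2_min_at_start hω) (k + 1) i hi
  have hmax := unfold_max_at_end hs2 i hi
  change fold k ω 0 0 ≤ fold k ω i 0 at hmin
  change fold k ω i 0 ≤ fold k ω k 0 at hmax
  have h00 : fold k ω 0 0 = 0 := by rw [hF0]; rfl
  rw [h00] at hmin
  exact ⟨hmin, hmax⟩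

/-- **The arch map** (vertex function): fold the arch in the direction of the wall, append one unit step along the wall,
and transpose back (wall coordinate second, height first). [cite: HammersleyTorrieWhittington1982, existence of the free energy κ; reported in BeatonGuttmannJensen2012Adsorption §1 p. 1 (arXiv:1110.6695v1)]
[cite: DuminilCopinKozmaYadin2014, Lemma 5 (proof, Step 1)] -/
def archWalk (k : ℕ) (ω : ℕ → Site 2) : ℕ → Site 2 := transposeWalk (snocStep k (fold k ω))

/-- **The arch map** (step word of length `k+1`). [cite: HammersleyTorrieWhittington1982, existence of the free energy κ; reported in BeatonGuttmannJensen2012Adsorption §1 p. 1 (arXiv:1110.6695v1)] -/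
def archWord (k : ℕ) (ω : ℕ → Site 2) : List Step := wordOf (k + 1) (archWalk k ω)

section ArchMap

variable {k : ℕ} {ω : ℕ → Site 2}

/-- The arch map lands in `saws 2 (k+1)`. [cite: DuminilCopinKozmaYadin2014, Lemma 5 (proof, Step 1)] -/
theorem archWalk_mem_saws (hω : ω ∈ saws 2 k) : archWalk k ω ∈ saws 2 (k + 1) :=
  transposeWalk_mem_saws (snocStep_mem_saws (fold_mem_saws hω) fun _ hi => (fold_apply_zero_mem hω hi).2)

/-- Heights are preserved: `(archWalk ω)(i)₀ = ω(i)₀` for `i ≤ k`. [cite: DuminilCopinKozmaYadin2014, Lemma 5 (proof, Step 1)] -/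
theorem archWalk_apply_zero (hω : ω ∈ saws 2 k) {i : ℕ} (hi : i ≤ k) : archWalk k ω i 0 = ω i 0 := by
  rw [archWalk, transposeWalk_apply_zero, snocStep_of_le _ hi, fold_apply_one hω hi]

/-- The wall coordinate up to time `k` is the first coordinate of the fold. [cite: MadrasSlade1993, §1.1–§1.2 (pp. 9–11)] -/
theorem archWalk_apply_one {i : ℕ} (hi : i ≤ k) : archWalk k ω i 1 = fold k ω i 0 := by
  rw [archWalk, transposeWalk_apply_one, snocStep_of_le _ hi]

/-- The appended vertex has the height of the arch's endpoint. [cite: MadrasSlade1993, §1.1–§1.2 (pp. 9–11)] -/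
theorem archWalk_succ_apply_zero (hω : ω ∈ saws 2 k) : archWalk k ω (k + 1) 0 = ω k 0 := by
  rw [archWalk, transposeWalk_apply_zero, snocStep_succ_apply_one, fold_apply_one hω le_rfl]

/-- The appended vertex is one further along the wall than the fold's endpoint. [cite: MadrasSlade1993, §1.1–§1.2 (pp. 9–11)] -/
theorem archWalk_succ_apply_one : archWalk k ω (k + 1) 1 = fold k ω k 0 + 1 := by
  rw [archWalk, transposeWalk_apply_one, snocStep_succ_apply_zero]

/-- The arch word has length `k+1`. [cite: MadrasSlade1993, §1.1–§1.2 (pp. 9–11)] -/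
@[simp] theorem length_archWord : (archWord k ω).length = k + 1 := length_wordOf _ _

/-- The trajectory of the arch word is the arch map. [cite: MadrasSlade1993, §1.1–§1.2 (pp. 9–11)] -/
theorem traj_archWord (hω : ω ∈ saws 2 k) : traj (archWord k ω) = archWalk k ω :=
  traj_wordOf (archWalk_mem_saws hω)

/-- **The image of an arch is a wall-returning `x`-bridge.** [cite: HammersleyTorrieWhittington1982, existence of the free energy κ; reported in BeatonGuttmannJensen2012Adsorption §1 p. 1 (arXiv:1110.6695v1)]
[cite: MadrasSlade1993, Definition 1.2.4 (p. 10)] -/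
theorem isWXB_archWord (hω : ω ∈ arches k) : AdsIrr.IsWXB (archWord k ω) := by
  obtain ⟨hhp, hend⟩ := mem_arches.1 hω
  obtain ⟨hs, hpos⟩ := mem_hpWalks.1 hhp
  have hT := traj_archWord hs
  have hW : wEnd (archWord k ω) = archWalk k ω (k + 1) := by
    rw [← traj_length, length_archWord, hT]
  refine ⟨?_, fun i hi => ?_, ?_, fun i hi => ?_, fun i hi => ?_⟩
  · rw [isSAW_iff_injOn, hT, length_archWord]
    exact (mem_saws.1 (archWalk_mem_saws hs)).2.2.2
  · rw [hT]
    rw [length_archWord] at hi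
    rcases Nat.lt_or_ge i (k + 1) with h | h
    · rw [archWalk_apply_zero hs (by omega)]; exact hpos i (by omega)
    · rw [show i = k + 1 by omega, archWalk_succ_apply_zero hs, hend]
  · rw [hW, archWalk_succ_apply_zero hs, hend]
  · rw [hT]
    rw [length_archWord] at hi
    rcases Nat.lt_or_ge i (k + 1) with h | h
    · rw [archWalk_apply_one (by omega)]; exact (fold_apply_zero_mem hs (by omega)).1
    · rw [show i = k + 1 by omega, archWalk_succ_apply_one]
      have := (fold_apply_zero_mem hs le_rfl).1
      omega
  · rw [hT, hW, archWalk_succ_apply_one]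
    rw [length_archWord] at hi
    rw [archWalk_apply_one (by omega)]
    have := (fold_apply_zero_mem hs (show i ≤ k by omega)).2
    omega

/-- The arch word is a piece of length `k+1`. [cite: HammersleyTorrieWhittington1982, existence of the free energy κ; reported in BeatonGuttmannJensen2012Adsorption §1 p. 1 (arXiv:1110.6695v1)] -/
theorem archWord_mem_wxbWords (hω : ω ∈ arches k) : archWord k ω ∈ AdsIrr.wxbWords (k + 1) :=
  AdsIrr.mem_wxbWords.2 ⟨length_archWord, isWXB_archWord hω⟩

/-- **Exactly one more wall visit** (the appended vertex; all other heights are those of the arch).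
[cite: HammersleyTorrieWhittington1982, existence of the free energy κ; reported in BeatonGuttmannJensen2012Adsorption §1 p. 1 (arXiv:1110.6695v1)] -/
theorem visits_archWord (hω : ω ∈ arches k) : AdsIrr.visits (archWord k ω) = wallVisits k ω + 1 := by
  classical
  obtain ⟨hhp, hend⟩ := mem_arches.1 hω
  obtain ⟨hs, -⟩ := mem_hpWalks.1 hhp
  rw [AdsIrr.visits_eq_wallVisits, length_archWord, traj_archWord hs]
  unfold wallVisits
  rw [Finset.range_add_one, Finset.filter_insert, if_pos ⟨Nat.succ_pos k, by rw [archWalk_succ_apply_zero hs, hend]⟩,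
    Finset.card_insert_of_notMem (fun h => by simp at h)]
  congr 1
  refine congrArg Finset.card (Finset.filter_congr fun j hj => ?_)
  rw [Finset.mem_range] at hj
  rw [archWalk_apply_zero hs (by omega)]

/-- **The arch map with the two unfolding codes is injective on arches** (the word determines the vertex function,
the transposition and `snocStep` are undone by restriction, and `Zd.fold_codes_injOn`).
[cite: DuminilCopinKozmaYadin2014, Lemma 5 (proof, Step 1)] -/
theorem archWord_codes_injOn (k : ℕ) :
    Set.InjOn (fun ω : ℕ → Site 2 => (archWord k ω, code k (foldStage2 k ω), code k (foldStage1 k ω)))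
      ↑(arches k) := by
  intro ω hω ω' hω' h
  simp only [Prod.mk.injEq] at h
  obtain ⟨hw, hc2, hc1⟩ := h
  have hs : ω ∈ saws 2 k := (mem_hpWalks.1 (mem_arches.1 hω).1).1
  have hs' : ω' ∈ saws 2 k := (mem_hpWalks.1 (mem_arches.1 hω').1).1
  -- the words determine the vertex functions
  have hA : archWalk k ω = archWalk k ω' := by
    rw [← traj_archWord hs, ← traj_archWord hs', hw]
  -- undo the transposition and the appended step
  have hS : snocStep k (fold k ω) = snocStep k (fold k ω') := by
    have := congrArg transposeWalk hA
    simpa only [archWalk, transposeWalk_transposeWalk] using this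
  have hF : fold k ω = fold k ω' := by
    obtain ⟨-, hend, -, -⟩ := mem_saws.1 (fold_mem_saws hs)
    obtain ⟨-, hend', -, -⟩ := mem_saws.1 (fold_mem_saws hs')
    funext i
    rcases le_or_gt i k with hi | hi
    · have := congrFun hS i
      rwa [snocStep_of_le _ hi, snocStep_of_le _ hi] at this
    · have := congrFun hS k
      rw [snocStep_of_le _ le_rfl, snocStep_of_le _ le_rfl] at this
      rw [hend i hi.le, hend' i hi.le, this]
  exact fold_codes_injOn k hs hs' (by simp only [Prod.mk.injEq]; exact ⟨hF, hc2, hc1⟩)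

end ArchMap

/-- **`a · A_k(a) ≤ (#codes_k)² · B_{k+1}(a)`** (`a ≥ 0`): the arch map multiplies each weight by `a` (one more visit),
lands in the pieces of length `k+1`, and is at most `(#finsetsOfSumLE k)²`-to-one.
[cite: HammersleyTorrieWhittington1982, existence of the free energy κ; reported in BeatonGuttmannJensen2012Adsorption §1 p. 1 (arXiv:1110.6695v1)] [cite: MadrasSlade1993, §3.1, eq. (3.1.4)–(3.1.5) (p. 60)] -/
theorem mul_archZ_le (k : ℕ) {a : ℝ} (ha : 0 ≤ a) :
    a * archZ k a ≤ ((finsetsOfSumLE k).card : ℝ) ^ 2 * AdsIrr.Bw (k + 1) a := by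
  classical
  set P := finsetsOfSumLE k with hP
  -- the weight of `ω` times `a` is the weight of its image
  have heq : a * archZ k a = ∑ ω ∈ arches k,
      (fun q : List Step × (Finset ℕ × Finset ℕ) => a ^ AdsIrr.visits q.1)
        (archWord k ω, code k (foldStage2 k ω), code k (foldStage1 k ω)) := by
    rw [archZ, Finset.mul_sum]
    refine Finset.sum_congr rfl fun ω hω => ?_
    simp only [visits_archWord hω, pow_succ, mul_comm]
  rw [heq]
  have hle := sum_comp_le_sum_of_injOn (s := arches k) (t := AdsIrr.wxbWords (k + 1) ×ˢ (P ×ˢ P))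
    (fun ω => (archWord k ω, code k (foldStage2 k ω), code k (foldStage1 k ω))) (archWord_codes_injOn k)
    (fun ω hω => by
      have hs : ω ∈ saws 2 k := (mem_hpWalks.1 (mem_arches.1 hω).1).1
      exact Finset.mem_product.2 ⟨archWord_mem_wxbWords hω, Finset.mem_product.2
        ⟨code_mem_finsetsOfSumLE (foldStage2_mem_saws hs), code_mem_finsetsOfSumLE (foldStage1_mem_saws hs)⟩⟩)
    (fun q => a ^ AdsIrr.visits q.1) (fun _ _ => pow_nonneg ha _)
  refine hle.trans (le_of_eq ?_)
  rw [Finset.sum_product, AdsIrr.Bw, Finset.mul_sum]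
  refine Finset.sum_congr rfl fun w _ => ?_
  simp only [Finset.sum_const, Finset.card_product, nsmul_eq_mul]
  push_cast
  ring

/-- **`a · A_k(a) ≤ e^{6√k} · B_{k+1}(a)`** (`a ≥ 0`). [cite: HammersleyTorrieWhittington1982, existence of the free energy κ; reported in BeatonGuttmannJensen2012Adsorption §1 p. 1 (arXiv:1110.6695v1)]
[cite: MadrasSlade1993, Proposition 3.1.5, eq. (3.1.5) (p. 60)] -/
theorem mul_archZ_le_exp (k : ℕ) {a : ℝ} (ha : 0 ≤ a) :
    a * archZ k a ≤ Real.exp (6 * Real.sqrt k) * AdsIrr.Bw (k + 1) a := by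
  refine (mul_archZ_le k ha).trans (mul_le_mul_of_nonneg_right ?_ (AdsIrr.Bw_nonneg _ ha))
  have hP := card_finsetsOfSumLE_le_exp k
  have hP0 : (0 : ℝ) ≤ (finsetsOfSumLE k).card := Nat.cast_nonneg _
  calc ((finsetsOfSumLE k).card : ℝ) ^ 2 ≤ (Real.exp (3 * Real.sqrt k)) ^ 2 := pow_le_pow_left₀ hP0 hP 2
    _ = Real.exp (6 * Real.sqrt k) := by rw [← Real.exp_nat_mul]; ring_nf

/-- For `a ≥ 1` the factor `a` may be dropped: **`A_k(a) ≤ e^{6√k} B_{k+1}(a)`**. [cite: HammersleyTorrieWhittington1982, existence of the free energy κ; reported in BeatonGuttmannJensen2012Adsorption §1 p. 1 (arXiv:1110.6695v1)] -/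
theorem archZ_le_exp_mul_Bw (k : ℕ) {a : ℝ} (ha : 1 ≤ a) :
    archZ k a ≤ Real.exp (6 * Real.sqrt k) * AdsIrr.Bw (k + 1) a := by
  have h0 : 0 ≤ a := zero_le_one.trans ha
  have h := mul_archZ_le_exp k h0
  have hA := archZ_nonneg k h0
  nlinarith

end Zd

end Literature.Probability.RandomPlanarGeometry.SAW
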